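import Summits.ResolutionOfSingularities.ResolutionOfSingularities.Theorems.FrobeniusClosingPatchingRelPerfectDepthWeightTwoBStepLaw
import Summits.ResolutionOfSingularities.ResolutionOfSingularities.Theorems.FrobeniusClosingPatchingRelPerfectDepthTargetsWeightedDefs
import Literature.AlgebraicGeometry.Resolution.HypersurfaceRestrictionTransform
import Literature.AlgebraicGeometry.Resolution.HypersurfaceTransform
import Literature.AlgebraicGeometry.Resolution.CartierDivisorControlledTransform
import Literature.AlgebraicGeometry.Resolution.MarkedIdealsArithmetic
import Literature.AlgebraicGeometry.Resolution.BlowupSNC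
import Literature.AlgebraicGeometry.Resolution.RegularBlowup
import HarnessLib

/-!
# Crux `PatchingRelPerfect` (stmt-ResolutionOfSingularities-16161), chain W5.2 — T6-E1b residual `LegalScopedDivisorReduction₃`,
# PHASE 2 closer (2b) «SURFACE-TRACE SEPARATION GAME», brick B1: the STATE, one LEGAL MOVE, and the TRACE LAW

[OURS · L1 W5.2 · res-L1-w52-lead-1 g5, hand #3b (OWNER RULING O1.3 of res-L1-w52-idea-1, 2026-08-27T11:55:07Z); plan
`L/res-L1-w52-lead-1/PHASE2-SEPARATION-GAME.md` v2] Replaces the role of NO printed item; NOT a statement of the manuscript under review;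
fact-free.

PHASE 2 of `LegalScopedDivisorReduction₃` starts from PHASE 1's output («host × boundary»: `H = D · M`, `D` an effective Cartier
ideal whose zero scheme `X = V(D)` is a REGULAR hypersurface, `M = monomialIdeal L` a monomial in a simple-normal-crossings boundary)
and must reach a state whose support lies in a strict normal crossings divisor, by weight-two-LEGAL blowings up only (regular centres
`C` with `H ≤ C²`, transform `τᶜ(H, 2)`). This file is the engine room of closer (2b):

* `HostState H D L` — the state carried: `E` regular; `H = D · monomialIdeal L`; `D` effective Cartier and a REGULAR HYPERSURFACE in the
  order-one-generator form (`D_x = (v)`, `v ∉ 𝔪_x²` at every point of `V(D)` — BGMW Lemma 3.6.4 (4), the form the tree transports);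
  `HasSNC (boundaryOf L)`.
* **`HostState.step`** — ONE MOVE: blowing up a regular irreducible closed centre `Z ⊆ V(D) ∩ Supp M` (generic point `η`) that has normal
  crossings with the boundary is weight-two LEGAL (`H ≤ 𝓘(Z)²`: both factors contain `Z`), and the transform is again a `HostState`:
  `τᶜ(H, 2) = τᶜ(D, 1) · monomialIdeal (stepExp L τ 𝓘(Z) (w − 1))`, `w = weightAt L η ≥ 1` (the monomial law of res-D-pv-054's
  `WeightTwoB.comap_monomialIdeal_single`, the exceptional divisor entering with exponent `w − 1`), the new host `τᶜ(D, 1)` again a regular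
  hypersurface (tree `IsBlowup.exists_generator_notMem_sq_controlledTransform`), the new boundary snc (`HasSNCWith.hasSNC_transform`);
  together with the pure-weight-two clause `H𝒪 = (𝓘(Z)𝒪)² · τᶜ(H, 2)`.
* **`HostState.trace_law`** — THE TRACE LAW on the strict transform `X′ = V(τᶜ(D, 1))` of the host, which is the blowing up of `X`
  along `𝓘(Z)|_X` (tree `IsBlowup.isBlowup_subscheme_controlledTransform`, BGMW §4 Remark (3)): the trace `M′|_{X′}` of the new boundary
  monomial is `(𝓘(Z)𝒪|_{X′})^{w−1} · (π_X)ᶜ(M|_X, w)` ([Wlod] Lemma 3.10.3 in the tree, `IsBlowup.comap_subschemeι_controlledTransform`).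
  For a POINT centre this is «strict transform of the trace + (mult − 1) × exceptional curve», for a CURVE centre `Γ ⊂ X` it is «trace − Γ».

AI-written; AI review is weaker than expert review.

## References
* E. Bierstone, D. Grigoriev, P. Milman, J. Włodarczyk, arXiv:1206.3090, Lemma 3.2.1, Lemma 3.6.4 (4)/(6), Lemma 3.7.1, §4 Remark (3).
  [BierstoneGrigorievMilmanWlodarczyk2011]
* J. Włodarczyk, J. AMS 18 (2005), Lemma 3.10.3. [Wlodarczyk2005]
* J. Kollár, *Lectures on Resolution of Singularities* (2007), (3.111) Step 1, 3.30.2. [Kollar2007]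
-/

-- `Summit.<Summit>.<Sub>.Theorems` with `Sub = Summit` (single-conjunct summit, D-0017)
set_option linter.dupNamespace false

noncomputable section

open CategoryTheory CategoryTheory.Limits AlgebraicGeometry TopologicalSpace IsLocalRing
open Literature.AlgebraicGeometry.Resolution Scheme.IdealSheafData

namespace Summit.ResolutionOfSingularities.ResolutionOfSingularities.Theorems

universe u

namespace DepthLegal

open WeightTwoB DepthTargets

variable {E : Scheme.{u}}

/-- [OURS · L1 W5.2] **The state of the separation game** on the current (regular) scheme: `H = D · monomialIdeal L` with `D` an
effective Cartier REGULAR HYPERSURFACE (order-one generators at its points) and `boundaryOf L` a simple-normal-crossings boundary.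
[cite: BierstoneGrigorievMilmanWlodarczyk2011, Lemma 3.6.4 (4), Def. 3.1.1] -/
structure HostState [IsLocallyNoetherian E] (H D : E.IdealSheafData) (L : List (E.IdealSheafData × ℕ)) : Prop where
  /-- the ambient scheme is regular -/
  regE : Scheme.IsRegular E
  /-- the factorisation host · boundary monomial -/
  fac : H = D * monomialIdeal L
  /-- the host is an effective Cartier divisor -/
  hostCartier : IsEffectiveCartier D
  /-- the host is a regular hypersurface: order-one generators -/
  hostHyp : ∀ x ∈ D.support, ∃ v : E.presheaf.stalk x,
    stalkIdeal D x = Ideal.span {v} ∧ v ∉ (maximalIdeal (E.presheaf.stalk x)) ^ 2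
  /-- the boundary has simple normal crossings -/
  sncB : HasSNC (boundaryOf L)

namespace HostState

section Step

variable [IsLocallyNoetherian E] {H D : E.IdealSheafData} {L : List (E.IdealSheafData × ℕ)} (S : HostState H D L)
  {Z : Closeds E} {η : E} {E' : Scheme.{u}} {τ : E' ⟶ E}

omit [IsLocallyNoetherian E] in
/-- The host contains the centre: `D ≤ 𝓘(Z)`. [folklore] -/
theorem host_le (hZX : (Z : Set E) ⊆ D.support) : D ≤ vanishingIdeal Z :=
  Scheme.IdealSheafData.le_support_iff_le_vanishingIdeal.mp hZX

omit [IsLocallyNoetherian E] in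
/-- The boundary monomial contains the centre: `M ≤ 𝓘(Z)`. [folklore] -/
theorem bd_le (hZM : (Z : Set E) ⊆ (monomialIdeal L).support) : monomialIdeal L ≤ vanishingIdeal Z :=
  Scheme.IdealSheafData.le_support_iff_le_vanishingIdeal.mp hZM

include S in
/-- **LEGALITY: a centre inside `V(D) ∩ Supp M` is weight-two permissible**: `H = D · M ≤ 𝓘(Z) · 𝓘(Z)`.
[cite: BierstoneGrigorievMilmanWlodarczyk2011, Lemma 3.2.1 (1)] -/
theorem le_sq (hZX : (Z : Set E) ⊆ D.support) (hZM : (Z : Set E) ⊆ (monomialIdeal L).support) :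
    H ≤ vanishingIdeal Z ^ 2 := by
  rw [S.fac, sq]
  exact mul_le_mul' (host_le hZX) (bd_le hZM)

include S in
/-- The weight of the boundary at the generic point of a centre inside `Supp M` is positive. [folklore] -/
theorem one_le_weightAt (hη : IsGenericPoint η (Z : Set E)) (hZM : (Z : Set E) ⊆ (monomialIdeal L).support) :
    1 ≤ weightAt L η :=
  (le_idealOrder_monomialIdeal_iff S.sncB 1 η).mp (by exact_mod_cast (one_le_idealOrder_iff _ η).mpr (hZM hη.mem))

include S in
/-- **The boundary law**: `τᶜ(M, 1) = monomialIdeal (stepExp L τ 𝓘(Z) (w − 1))`, `w = weightAt L η` — the strict transforms with their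
exponents and the exceptional divisor with exponent `w − 1` (`M𝒪 = (𝓘(Z)𝒪)^w · ∏ 𝓘(B′)^{c_B}`, `WeightTwoB.comap_monomialIdeal_single`).
[cite: Kollar2007, (3.111) Step 1] -/
theorem bd_transform (hη : IsGenericPoint η (Z : Set E)) (hZM : (Z : Set E) ⊆ (monomialIdeal L).support)
    (hnc : HasSNCWith (boundaryOf L) (vanishingIdeal Z)) (hτ : IsBlowup τ (vanishingIdeal Z)) :
    controlledTransform τ (vanishingIdeal Z) (monomialIdeal L) 1 =
      monomialIdeal (stepExp L τ (vanishingIdeal Z) (weightAt L η - 1)) := by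
  haveI : IsLocallyNoetherian E' := hτ.isLocallyNoetherian
  have hw := S.one_le_weightAt hη hZM
  have hcomap := comap_monomialIdeal_single hη hnc hτ
  obtain ⟨k, hk⟩ := Nat.exists_eq_add_of_le hw
  rw [monomialIdeal_stepExp, hk, Nat.add_sub_cancel_left]
  rw [hk, pow_add, pow_one, mul_assoc] at hcomap
  unfold controlledTransform
  rw [hcomap, pow_one]
  have h := colon_pow_mul_eq hτ.isEffectiveCartier
    ((vanishingIdeal Z).comap τ ^ k * monomialIdeal (L.map fun p => (strictTransformIdeal τ (vanishingIdeal Z) p.1, p.2))) 1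
  rw [pow_one] at h
  rw [h, mul_comm]

include S in
/-- **The factorisation one step up**: `τᶜ(H, 2) = τᶜ(D, 1) · monomialIdeal (stepExp L τ 𝓘(Z) (w − 1))` (multiplicativity of the controlled
transform, BGMW Lemma 3.7.1, with `D, M ≤ 𝓘(Z)`). [cite: BierstoneGrigorievMilmanWlodarczyk2011, Lemma 3.7.1] -/
theorem fac' (hη : IsGenericPoint η (Z : Set E)) (hZX : (Z : Set E) ⊆ D.support) (hZM : (Z : Set E) ⊆ (monomialIdeal L).support)
    (hnc : HasSNCWith (boundaryOf L) (vanishingIdeal Z)) (hτ : IsBlowup τ (vanishingIdeal Z)) :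
    controlledTransform τ (vanishingIdeal Z) H 2 =
      controlledTransform τ (vanishingIdeal Z) D 1 * monomialIdeal (stepExp L τ (vanishingIdeal Z) (weightAt L η - 1)) := by
  haveI : IsLocallyNoetherian E' := hτ.isLocallyNoetherian
  have h1 : D.comap τ ≤ (vanishingIdeal Z).comap τ ^ 1 := by
    rw [pow_one]; exact Scheme.IdealSheafData.comap_mono (f := τ) (host_le hZX)
  have h2 : (monomialIdeal L).comap τ ≤ (vanishingIdeal Z).comap τ ^ 1 := by
    rw [pow_one]; exact Scheme.IdealSheafData.comap_mono (f := τ) (bd_le hZM)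
  rw [S.fac, show (2 : ℕ) = 1 + 1 from rfl, controlledTransform_mul hτ.isEffectiveCartier h1 h2, S.bd_transform hη hZM hnc hτ]

include S in
/-- **The pure-weight-two clause** `H𝒪 = (𝓘(Z)𝒪)² · τᶜ(H, 2)`. [cite: BierstoneGrigorievMilmanWlodarczyk2011, §3.2] -/
theorem comap_eq (hZX : (Z : Set E) ⊆ D.support) (hZM : (Z : Set E) ⊆ (monomialIdeal L).support)
    (hτ : IsBlowup τ (vanishingIdeal Z)) :
    H.comap τ = (vanishingIdeal Z).comap τ ^ 2 * controlledTransform τ (vanishingIdeal Z) H 2 :=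
  hτ.comap_eq_pow_mul_controlledTransform_of_le_pow (S.le_sq hZX hZM)

include S in
/-- [OURS · L1 W5.2] **ONE MOVE of the separation game.** Blowing up a regular irreducible closed centre `Z ⊆ V(D) ∩ Supp M` having normal
crossings with the boundary transports the state: `τᶜ(H, 2) = τᶜ(D, 1) · monomialIdeal (stepExp L τ 𝓘(Z) (w − 1))` with the new host a
regular hypersurface (BGMW Lemma 3.6.4 (4)) and the new boundary snc. [cite: BierstoneGrigorievMilmanWlodarczyk2011, Lemma 3.6.4 (4)]
[cite: Kollar2007, (3.111) Step 1] -/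
theorem step (hη : IsGenericPoint η (Z : Set E)) (hZ : Scheme.IsRegular (vanishingIdeal Z).subscheme)
    (hZX : (Z : Set E) ⊆ D.support) (hZM : (Z : Set E) ⊆ (monomialIdeal L).support)
    (hnc : HasSNCWith (boundaryOf L) (vanishingIdeal Z)) (hτ : IsBlowup τ (vanishingIdeal Z)) :
    @HostState E' hτ.isLocallyNoetherian (controlledTransform τ (vanishingIdeal Z) H 2) (controlledTransform τ (vanishingIdeal Z) D 1)
      (stepExp L τ (vanishingIdeal Z) (weightAt L η - 1)) := by
  haveI : IsLocallyNoetherian E' := hτ.isLocallyNoetherian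
  exact
    { regE := hτ.isRegular_of_isRegular_subscheme S.regE hZ
      fac := S.fac' hη hZX hZM hnc hτ
      hostCartier := hτ.isEffectiveCartier_controlledTransform_of_le_pow S.hostCartier (by rw [pow_one]; exact host_le hZX)
      hostHyp := fun x' hx' =>
        hτ.exists_generator_notMem_sq_controlledTransform S.regE hZ (host_le hZX) S.hostHyp x' hx'
      sncB := by rw [boundaryOf_stepExp]; exact hnc.hasSNC_transform hτ }

include S in
/-- The move as ONE pure-weight-two step (to be appended to a running `IsPureWeightedSeq 2`). [folklore] -/
theorem isPureWeightedSeq_cons {E₀ : Scheme.{u}} {ρ : E ⟶ E₀} {H₀ : E₀.IdealSheafData} (hseq : IsPureWeightedSeq 2 ρ H₀ H)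
    (hZ : Scheme.IsRegular (vanishingIdeal Z).subscheme) (hZX : (Z : Set E) ⊆ D.support)
    (hZM : (Z : Set E) ⊆ (monomialIdeal L).support) (hτ : IsBlowup τ (vanishingIdeal Z)) :
    IsPureWeightedSeq 2 (τ ≫ ρ) H₀ (controlledTransform τ (vanishingIdeal Z) H 2) :=
  IsPureWeightedSeq.cons τ ρ H₀ H _ (vanishingIdeal Z) hseq hZ (S.le_sq hZX hZM) hτ (S.comap_eq hZX hZM hτ)

end Step

/-! ## The trace law on the strict transform of the host -/

section Trace

variable [IsLocallyNoetherian E] {H D : E.IdealSheafData} {L : List (E.IdealSheafData × ℕ)} (S : HostState H D L)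
  {Z : Closeds E} {η : E} {E' : Scheme.{u}} {τ : E' ⟶ E}

include S in
/-- **The strict transform of the host is the blowing up of the host along the restricted centre** (BGMW §4 Remark (3), tree
`IsBlowup.isBlowup_subscheme_controlledTransform`): every morphism `π_X : V(τᶜ(D,1)) → V(D)` over `τ` is a blowing up along `𝓘(Z)|_{V(D)}`.
[cite: BierstoneGrigorievMilmanWlodarczyk2011, §4 Remark (3)] -/
theorem isBlowup_host (hZ : Scheme.IsRegular (vanishingIdeal Z).subscheme) (hZX : (Z : Set E) ⊆ D.support)
    (hτ : IsBlowup τ (vanishingIdeal Z))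
    (πX : (controlledTransform τ (vanishingIdeal Z) D 1).subscheme ⟶ D.subscheme)
    (hπX : πX ≫ D.subschemeι = (controlledTransform τ (vanishingIdeal Z) D 1).subschemeι ≫ τ) :
    IsBlowup πX ((vanishingIdeal Z).comap D.subschemeι) :=
  hτ.isBlowup_subscheme_controlledTransform S.regE hZ (host_le hZX) S.hostHyp πX hπX

include S in
/-- [OURS · L1 W5.2] **THE TRACE LAW.** With `X = V(D)`, `X′ = V(τᶜ(D,1))`, `π_X : X′ → X` over `τ`, `w = weightAt L η`: the trace of the
new boundary monomial on the strict transform of the host is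
`(monomialIdeal L′)|_{X′} = (𝓘(Z)𝒪|_{X′})^{w−1} · (π_X)ᶜ(M|_X, w)` — restriction to the hypersurface commutes with the controlled
transform ([Wlod] 3.10.3, tree `IsBlowup.comap_subschemeι_controlledTransform`). [cite: Wlodarczyk2005, Lemma 3.10.3]
[cite: BierstoneGrigorievMilmanWlodarczyk2011, Lemma 3.9.4] -/
theorem trace_law (hη : IsGenericPoint η (Z : Set E)) (hZ : Scheme.IsRegular (vanishingIdeal Z).subscheme)
    (hZX : (Z : Set E) ⊆ D.support)
    (hnc : HasSNCWith (boundaryOf L) (vanishingIdeal Z)) (hτ : IsBlowup τ (vanishingIdeal Z))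
    (πX : (controlledTransform τ (vanishingIdeal Z) D 1).subscheme ⟶ D.subscheme)
    (hπX : πX ≫ D.subschemeι = (controlledTransform τ (vanishingIdeal Z) D 1).subschemeι ≫ τ) :
    (monomialIdeal (stepExp L τ (vanishingIdeal Z) (weightAt L η - 1))).comap
        (controlledTransform τ (vanishingIdeal Z) D 1).subschemeι =
      ((vanishingIdeal Z).comap D.subschemeι).comap πX ^ (weightAt L η - 1) *
        controlledTransform πX ((vanishingIdeal Z).comap D.subschemeι) ((monomialIdeal L).comap D.subschemeι) (weightAt L η) := by
  haveI : IsLocallyNoetherian E' := hτ.isLocallyNoetherian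
  -- `M𝒪 = (C𝒪)^w · ∏ 𝓘(B′)^{c_B}`, so `M𝒪 ≤ (C𝒪)^w` and the weight-`w` restriction law applies to `M`
  have hcomap := comap_monomialIdeal_single hη hnc hτ
  have hle : (monomialIdeal L).comap τ ≤ (vanishingIdeal Z).comap τ ^ weightAt L η := by
    rw [hcomap]
    exact Scheme.IdealSheafData.le_def.mpr fun U => by
      rw [Scheme.IdealSheafData.ideal_mul, Pi.mul_apply]; exact Ideal.mul_le_right
  have hlaw := hτ.comap_subschemeι_controlledTransform S.regE hZ (host_le hZX) S.hostHyp πX hπX hle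
  -- `monomialIdeal L′ = (C𝒪)^{w-1} · τᶜ(M, w)`
  have hctrl : controlledTransform τ (vanishingIdeal Z) (monomialIdeal L) (weightAt L η) =
      monomialIdeal (L.map fun p => (strictTransformIdeal τ (vanishingIdeal Z) p.1, p.2)) := by
    unfold controlledTransform
    rw [hcomap]
    exact colon_pow_mul_eq hτ.isEffectiveCartier _ _
  have hfac : monomialIdeal (stepExp L τ (vanishingIdeal Z) (weightAt L η - 1)) =
      (vanishingIdeal Z).comap τ ^ (weightAt L η - 1) * controlledTransform τ (vanishingIdeal Z) (monomialIdeal L) (weightAt L η) := by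
    rw [monomialIdeal_stepExp, hctrl, mul_comm]
  -- restrict, and use functoriality of `comap` along the square `πX ≫ ι = ι′ ≫ τ`
  have hexc : ((vanishingIdeal Z).comap τ).comap (controlledTransform τ (vanishingIdeal Z) D 1).subschemeι =
      ((vanishingIdeal Z).comap D.subschemeι).comap πX := by
    rw [← Scheme.IdealSheafData.comap_comp, ← Scheme.IdealSheafData.comap_comp, hπX]
  rw [hfac, comap_mul, comap_pow, hexc, hlaw]

end Trace

end HostState

end DepthLegal

end Summit.ResolutionOfSingularities.ResolutionOfSingularities.Theorems

end
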